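import Summits.CriticalPhenomena.PercolationContinuityZ3.Theorems.Transplant.SkelFrmBChoiceZone
import Summits.CriticalPhenomena.PercolationContinuityZ3.Theorems.Transplant.SkelFrmBChoiceKit
import Summits.CriticalPhenomena.PercolationContinuityZ3.Theorems.Transplant.SkelFrmBChoiceLinks
import HarnessLib

/-!
# N2 (frames-only node `SamePDropOfSkeletonFrm₁`, OPEN), (R) column, ruling (R-42) (J20, design owner p3-g17 2026-08-23): **THE ROOT'S WIRED SEED IS THE FAT SEED
# AT LEVEL `k`** — the zone rows and the long links of the (S0) root leg AT THE SEED LEVEL `O.merged.k` (N1's instantiation, SkelPhiRootNegBXTA :193)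

The root skeletons' successors `NegB.rootLegAt_frmQ3K_fst/_snd` feed the leg `rootChainF_of_bridgeSchedC(₃)` with the zone family `O.merged.Λ` at index
`kz := O.merged.k` and seed radius `ρ := fatRadius Φ.frame hC O.merged.k` (so that the rim-excess rows `hρπ/hR₁/hR₁b/hR₁r` are stmt's SlotsS §4 devices
`fat_le_Rπ`/`hR₁_US`/`SRex_fat_le_Rπ_sub` VERBATIM — J20: at `kz := M_u`, `ρ := Rs` they are not dischargeable).  This file serves the level-`k` rows:
* §1 `zoneK_eq_fatSeq`, **`hΛRgK_of_atQ`** (`Λ c k ⊆ RgK … c`, via `Λ c k ⊆ Λ c M_u`), **`hzconnK_of_atQ`** (`Λ c k` is connected from `c` inside itself),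
  `hczK_of_atQ` (= `hczAt_of_atQ c k`), **`hZρK_of_atQ`** (`Λ t k ⊆ B(t, fatRadius … k)`), `hZρK_Rs_of_atQ` (`⊆ B(t, Rs)`, for the footprint rows),
  `zoneK_subset_cyl_φL` (`⊆ cyl φL c k`);
* §2 **`hlongK_of_atQ3` / `hlongYK_of_atQ3`** — p3-g16's `hlong/hlongY_of_atQ3` with the zone AT LEVEL `k` (Step I‴ serves the links there; the `M_u` versions are
  these followed by `zone_k_subset_zone_Mu`).
builds on p205010 (kernel theorem, internal audit signed; external expert review pending) — nothing in this file uses p205010; NOTHING is claimed about the open node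
`SamePDropOfSkeletonFrm₁`.
Lane `prim-bschramm`, seat `prim-bschramm-p3` (gen 17; N2 design owner, (R) column owner); helper file (`--supports stmt-CriticalPhenomena-4575 --as helper`).
[cite: KozmaNitzan2024, §4 p. 16 (Lemma 9: the seed), pp. 19–21, p. 28 ((32) at the root)] [cite: MartineauTassion2017, §3.2 Lemma 3.5]
-/

noncomputable section

open scoped Classical

namespace Summit.CriticalPhenomena.PercolationContinuityZ3.Theorems.Transplant

open MeasureTheory Literature.Probability.Percolation Literature.Probability.LatticeModels SimpleGraph KNCells KNLevels
open Literature.Barriers.CriticalPhenomena (graphBall graphBall_mono)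

namespace PlanarSkeletonFrm

open SkelConc (Consts)
open Skelφ (oriφ trφ)
open Skelφ.StepI (DataN DataNS OutNS)

namespace NegB

open Neg

section AtQ

variable {κ : Consts} {V : Type} [DecidableEq V] [Countable V] {G : SimpleGraph V} [G.LocallyFinite] {Φ : PlanarSkeletonFrm G} {t : V} {p : unitInterval}
  {hC : Φ.CylSubcritical p} {gv fv : Neg.FSlot} {Pv : PSlot} {Sv : SSlot} {cv : CSlot} {bv : BSlot} {O : OutNS V} {q : unitInterval}

/-! ## §1 The zone rows at the seed level -/

/-- The zone at the seed level IS the fat seed: `Λ c k = fatSeq c k`. [folklore] -/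
theorem zoneK_eq_fatSeq (hAt : (choiceAtQ3 κ Φ t p Pv gv fv Sv cv bv hC).AtQNQ O q) (c : V) :
    O.merged.Λ c O.merged.k = Skelφ.fatSeq Φ.frame hC c O.merged.k := by
  obtain ⟨-, -, -, -, hΛeq⟩ := Skelφ.StepI.OutO.FactsO.seed hAt.1.factsO
  exact congrFun (congrFun hΛeq c) _

/-- **`hΛRg` at level `k`**: `Λ c k ⊆ RgK … c` for every kit index `mk`. [folklore] -/
theorem hΛRgK_of_atQ (mk : ℕ) (hAt : (choiceAtQ3 κ Φ t p Pv gv fv Sv cv bv hC).AtQNQ O q) :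
    ∀ c, O.merged.Λ c O.merged.k ⊆ KS.RgK G t O.merged mk (KS.φK Φ t O.D O.DT.toDataN O.ori mk) c :=
  fun c => (zone_k_subset_zone_Mu hAt c).trans (hΛRg_of_atQ mk hAt c)

/-- **`hzconn` at level `k`**: the seed-level zone is connected from its centre inside itself. [folklore] -/
theorem hzconnK_of_atQ (hAt : (choiceAtQ3 κ Φ t p Pv gv fv Sv cv bv hC).AtQNQ O q) :
    ∀ c, ∀ s ∈ O.merged.Λ c O.merged.k, PathIn G (↑(O.merged.Λ c O.merged.k) : Set V) c s := by
  intro c s hs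
  have e := zoneK_eq_fatSeq hAt c
  have eset : (↑(O.merged.Λ c O.merged.k) : Set V) = Skelφ.cylBall G Φ.φ c O.merged.k (Skelφ.fatRadius Φ.frame hC O.merged.k) := by
    ext v; rw [Finset.mem_coe, e, Skelφ.mem_fatSeq_iff]
  rw [eset]
  have hs' : s ∈ Skelφ.cylBall G Φ.φ c O.merged.k (Skelφ.fatRadius Φ.frame hC O.merged.k) := by
    rw [e, Skelφ.mem_fatSeq_iff] at hs; exact hs
  exact Skelφ.pathIn_cylBall (G := G) (φ := Φ.φ) hs'

/-- **`hcz` at level `k`**. [folklore] -/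
theorem hczK_of_atQ (hAt : (choiceAtQ3 κ Φ t p Pv gv fv Sv cv bv hC).AtQNQ O q) : ∀ c, c ∈ O.merged.Λ c O.merged.k :=
  fun c => hczAt_of_atQ hAt c O.merged.k

/-- **`hZρ` at level `k`**: the fat seed lies in the graph ball of radius `fatRadius … k` (= `ψπ`) about its centre. [folklore] -/
theorem hZρK_of_atQ (hAt : (choiceAtQ3 κ Φ t p Pv gv fv Sv cv bv hC).AtQNQ O q) (c : V) :
    ∀ a ∈ O.merged.Λ c O.merged.k, a ∈ graphBall G c (Skelφ.fatRadius Φ.frame hC O.merged.k) := by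
  intro a ha
  rw [zoneK_eq_fatSeq hAt c, Skelφ.mem_fatSeq_iff] at ha
  exact (Skelφ.cylBall_subset_prism G Φ.φ c _ _ ha).1

/-- The seed-level zone at the root inside `B(t, Rs)` (for the footprint rows; `Λ t k ⊆ Λ t M_u ⊆ RgK ⊆ B(t, Rs)`). [folklore] -/
theorem hZρK_Rs_of_atQ (mk : ℕ) (hAt : (choiceAtQ3 κ Φ t p Pv gv fv Sv cv bv hC).AtQNQ O q) (c : V) :
    ∀ a ∈ O.merged.Λ c O.merged.k, a ∈ graphBall G c (KS.Rs t O.merged mk) :=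
  fun a ha => KS.RgK_subset_graphBall (G := G) t O.merged mk _ c a (hΛRgK_of_atQ mk hAt c ha)

/-- The seed-level zone inside the cylinder of `φL` of half-width `k`. [folklore] -/
theorem zoneK_subset_cyl_φL (hAt : (choiceAtQ3 κ Φ t p Pv gv fv Sv cv bv hC).AtQNQ O q) (c : V) :
    (↑(O.merged.Λ c O.merged.k) : Set V) ⊆ Skelφ.cyl (φL κ Φ t p O.D O.DT.toDataN O.ori (gOf κ Φ t p O gv) (fOf κ Φ t p O fv)) c O.merged.k := by
  unfold NegB.φL
  rw [Skelφ.cyl_oriφ, zoneK_eq_fatSeq hAt c]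
  exact Skelφ.fatSeq_subset_cyl Φ.frame hC c _

/-- `1 ≤ k` and `k ≤ M_u`. [folklore] -/
theorem hk_of_atQ (hAt : (choiceAtQ3 κ Φ t p Pv gv fv Sv cv bv hC).AtQNQ O q) : 1 ≤ O.merged.k ∧ O.merged.k ≤ Mu O.merged := by
  obtain ⟨-, h1k, hkM₀, -, -⟩ := Skelφ.StepI.OutO.FactsO.seed hAt.1.factsO
  exact ⟨h1k, k_le_Mu O.merged hkM₀⟩

/-! ## §2 The long links from the seed-level zone -/

/-- **`hlong` AT EVERY CENTRE, zone at level `k`** (accuracy `1 − a³`, `a ≥ δkit`, served sign `σ = 1`). [cite: KozmaNitzan2024, §4 pp. 19–21] -/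
theorem hlongK_of_atQ3 (hAt : (choiceAtQ3 κ Φ t p Pv gv fv Sv cv bv hC).AtQNQ O q) (h1 : Φ.types = {t}) {a : ℝ} (ha : Neg.δkit κ Φ ≤ a) :
    ∀ (c : V) (τ : ℤ), τ = 1 ∨ τ = -1 → 1 - a ^ 3 < (bondPercolation G q).real
      (linkIn (Skelφ.pgramPrism G (φL κ Φ t p O.D O.DT.toDataN O.ori (gOf κ Φ t p O gv) (fOf κ Φ t p O fv)) c
          (nL κ Φ t p O.merged (gOf κ Φ t p O gv) (fOf κ Φ t p O fv)) (hL κ Φ t p O.merged (gOf κ Φ t p O gv) (fOf κ Φ t p O fv))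
          (3 * ℓL κ Φ t p O.merged (gOf κ Φ t p O gv) (fOf κ Φ t p O fv)) (RL κ Φ t p O gv fv))
        (O.merged.Λ c O.merged.k)
        (Skelφ.pgSideHalfW G (φL κ Φ t p O.D O.DT.toDataN O.ori (gOf κ Φ t p O gv) (fOf κ Φ t p O fv)) c
          (nL κ Φ t p O.merged (gOf κ Φ t p O gv) (fOf κ Φ t p O fv)) (hL κ Φ t p O.merged (gOf κ Φ t p O gv) (fOf κ Φ t p O fv))
          (ℓL κ Φ t p O.merged (gOf κ Φ t p O gv) (fOf κ Φ t p O fv)) (RL κ Φ t p O gv fv) 1 (1 * τ))) := by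
  intro c τ hτ
  obtain ⟨τu, hτu⟩ : ∃ τu : ℤˣ, (τu : ℤ) = τ := by
    rcases hτ with rfl | rfl
    · exact ⟨1, Units.val_one⟩
    · exact ⟨-1, by simp⟩
  have h := inputsLAt_of_atQ hAt h1 c 0 τu
  rw [Skelφ.StepI.eventNAt_some] at h
  unfold Skelφ.StepI.regionNAt Skelφ.StepI.pieceNAt at h
  rw [if_pos rfl, Units.val_one, hτu] at h
  rw [one_mul]
  have hcube := δI3_le_cube_of_le κ Φ ha
  refine lt_of_le_of_lt (by linarith) (h.trans_le (measureReal_mono ?_ (measure_ne_top _ _)))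
  exact linkIn_mono le_rfl subset_rfl subset_rfl

/-- **`hlongY` AT EVERY CENTRE, zone at level `k`** (top pieces, split point `vL`). [cite: KozmaNitzan2024, §4 pp. 19–21] -/
theorem hlongYK_of_atQ3 (hAt : (choiceAtQ3 κ Φ t p Pv gv fv Sv cv bv hC).AtQNQ O q) (h1 : Φ.types = {t}) {a : ℝ} (ha : Neg.δkit κ Φ ≤ a) :
    ∀ (c : V) (τ : ℤ), τ = 1 ∨ τ = -1 → 1 - a ^ 3 < (bondPercolation G q).real
      (linkIn (Skelφ.pgramPrism G (φL κ Φ t p O.D O.DT.toDataN O.ori (gOf κ Φ t p O gv) (fOf κ Φ t p O fv)) c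
          (nL κ Φ t p O.merged (gOf κ Φ t p O gv) (fOf κ Φ t p O fv)) (hL κ Φ t p O.merged (gOf κ Φ t p O gv) (fOf κ Φ t p O fv))
          (3 * ℓL κ Φ t p O.merged (gOf κ Φ t p O gv) (fOf κ Φ t p O fv)) (RL κ Φ t p O gv fv))
        (O.merged.Λ c O.merged.k)
        (Skelφ.pgTopPieceW G (φL κ Φ t p O.D O.DT.toDataN O.ori (gOf κ Φ t p O gv) (fOf κ Φ t p O fv)) c
          (nL κ Φ t p O.merged (gOf κ Φ t p O gv) (fOf κ Φ t p O fv)) (hL κ Φ t p O.merged (gOf κ Φ t p O gv) (fOf κ Φ t p O fv))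
          (ℓL κ Φ t p O.merged (gOf κ Φ t p O gv) (fOf κ Φ t p O fv)) (RL κ Φ t p O gv fv) 1 τ
          (vL κ Φ t p O.merged (gOf κ Φ t p O gv) (fOf κ Φ t p O fv)))) := by
  intro c τ hτ
  obtain ⟨τu, hτu⟩ : ∃ τu : ℤˣ, (τu : ℤ) = τ := by
    rcases hτ with rfl | rfl
    · exact ⟨1, Units.val_one⟩
    · exact ⟨-1, by simp⟩
  have h := inputsLAt_of_atQ hAt h1 c 1 τu
  rw [Skelφ.StepI.eventNAt_some] at h
  unfold Skelφ.StepI.regionNAt Skelφ.StepI.pieceNAt at h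
  rw [if_neg (by decide), Units.val_one, hτu] at h
  have hcube := δI3_le_cube_of_le κ Φ ha
  refine lt_of_le_of_lt (by linarith) (h.trans_le (measureReal_mono ?_ (measure_ne_top _ _)))
  exact linkIn_mono le_rfl subset_rfl subset_rfl

end AtQ

end NegB

end PlanarSkeletonFrm

end Summit.CriticalPhenomena.PercolationContinuityZ3.Theorems.Transplant

end
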